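import Summits.AtomisticToContinuum.Crystallization.Theorems.ReggeStarCoercivityDefectFreeCrystallizesLayeredGluing07

/-!
# Part 8 of the proof of `stub_layeredGluing : LayeredGluing` (S5a, line `prestress-split-korn`, crux stmt-AtomisticToContinuum-13603); see the module docstring of the final part `ReggeStarCoercivityDefectFreeCrystallizesLayeredGluing.lean` for the overview
-/

noncomputable section

open scoped BigOperators Classical InnerProductSpace
open Filter Topology

namespace Summit.AtomisticToContinuum.Crystallization.Theorems.PrestressSplitKorn

open Summit.AtomisticToContinuum.Crystallization.Theses
open Summit.AtomisticToContinuum.Crystallization.Theses.ReggeStarCoercivity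
open Summit.AtomisticToContinuum.Crystallization.Theorems.DefectFreeCrystallizes.Negative.PredicateAPI
open Literature.MathematicalPhysics.StatisticalMechanics Literature.Geometry.DiscreteGeometry


section Sites

variable {a : ℝ} {s : ℤ → ℤ} {z : ℤ → ℝ}

section GenericStep

variable {Y : Set (EuclideanSpace ℝ (Fin 3))} {q : EuclideanSpace ℝ (Fin 3)} {E : EuclideanSpace ℝ (Fin 3) ≃ₗᵢ[ℝ] (EuclideanSpace ℝ (Fin 3))} {a' : ℝ} {s' : ℤ → ℤ} {z' : ℤ → ℝ}

/-- The pull-back of the vertical by the frame. -/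
theorem inner_frame_two (E : EuclideanSpace ℝ (Fin 3) ≃ₗᵢ[ℝ] (EuclideanSpace ℝ (Fin 3))) (x : EuclideanSpace ℝ (Fin 3)) : (E x) 2 = ⟪x, E.symm (layerNormal 1)⟫_ℝ := by
  have : (E x) 2 = ⟪E x, layerNormal 1⟫_ℝ := by
    rw [real_inner_fin3]; simp [layerNormal]
  rw [this, ← LinearIsometryEquiv.inner_map_map E x (E.symm (layerNormal 1)), LinearIsometryEquiv.apply_symm_apply]

/-- Auxiliary step `norm_frame_normal` of the proof of `stub_layeredGluing` (S5a); see the final part's module docstring. -/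
theorem norm_frame_normal (E : EuclideanSpace ℝ (Fin 3) ≃ₗᵢ[ℝ] (EuclideanSpace ℝ (Fin 3))) : ‖E.symm (layerNormal 1)‖ = 1 := by
  rw [LinearIsometryEquiv.norm_map]
  have : ‖(layerNormal 1 : EuclideanSpace ℝ (Fin 3))‖ ^ 2 = 1 := by rw [norm_sq_fin3]; simp [layerNormal]
  nlinarith [norm_nonneg (layerNormal 1 : EuclideanSpace ℝ (Fin 3))]

/-- **The correspondence of neighbour labels.** Every neighbour site of the known structure is the
image of a neighbour site of the template. -/
theorem exists_phi (hH : HalfFramedAt a Y q s z) (hT : TemplateAt Y q E a' s' z') :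
    ∃ φ : ℤ × ℤ × ℤ → ℤ × ℤ × ℤ, (∀ l ∈ nbrLabels s, φ l ∈ nbrLabels s' ∧
      E (layeredPos a' s' z' (φ l)) = layeredPos a s z l) ∧ Set.InjOn φ (nbrLabels s) ∧
      (∀ l' ∈ nbrLabels s', ∃ l ∈ nbrLabels s, φ l = l') := by
  obtain ⟨hbox, hs, hz0, hK, hM⟩ := hH
  obtain ⟨hbox', hs', hz0', hN1, hN2⟩ := hT
  have key : ∀ l ∈ nbrLabels s, ∃ l' ∈ nbrLabels s', E (layeredPos a' s' z' l') = layeredPos a s z l := by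
    intro l hl
    have hn := norm_nbrSite hbox hs hz0 hl
    have hmem : q + layeredPos a s z l ∈ Y := hM l (by linarith [hn.2]) (nbrLabels_fst_le hl).2
    obtain ⟨l', hl'⟩ := hN1 _ hmem (by rw [dist_eq_norm, add_sub_cancel_left]; linarith [hn.2])
    have he : E (layeredPos a' s' z' l') = layeredPos a s z l := by
      have := hl'; rw [add_right_inj] at this; exact this.symm
    refine ⟨l', ?_, he⟩
    have hn' : ‖layeredPos a' s' z' l'‖ = ‖layeredPos a s z l‖ := by
      rw [← he, LinearIsometryEquiv.norm_map]
    have hl'0 : l' ≠ 0 := by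
      intro h0
      rw [h0, show (0 : ℤ × ℤ × ℤ) = ((0 : ℤ), (0 : ℤ), (0 : ℤ)) from rfl, layeredPos_origin hz0',
        norm_zero] at hn'
      linarith [hn.1, hbox.a_pos]
    exact mem_nbrLabels.2 (mem_labels_of_norm_le hbox' hs' hz0' hl'0 (by linarith [hn.2]))
  choose! φ hφ using key
  have hinj : Set.InjOn φ (nbrLabels s) := by
    intro l₁ h₁ l₂ h₂ heq
    have e1 := (hφ l₁ h₁).2
    have e2 := (hφ l₂ h₂).2
    rw [heq] at e1
    exact layeredPos_injective_of_inBox hbox (e1.symm.trans e2)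
  refine ⟨φ, hφ, hinj, ?_⟩
  -- surjectivity by counting
  have himg : (nbrLabels s).image φ = nbrLabels s' := by
    apply Finset.eq_of_subset_of_card_le
    · intro l' hl'
      obtain ⟨l, hl, rfl⟩ := Finset.mem_image.1 hl'
      exact (hφ l hl).1
    · rw [Finset.card_image_of_injOn hinj, card_nbrLabels hs, card_nbrLabels hs']
  intro l' hl'
  rw [← himg] at hl'
  obtain ⟨l, hl, rfl⟩ := Finset.mem_image.1 hl'
  exact ⟨l, hl, rfl⟩

/-- Auxiliary step `hex_det2` of the proof of `stub_layeredGluing` (S5a); see the final part's module docstring. -/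
theorem hex_det2 : ∀ x ∈ hexLabels, ∀ y ∈ hexLabels, x.2.1 * y.2.2 - y.2.1 * x.2.2 = 0 → y = x ∨ y = -x := by
  decide

/-- Auxiliary step `neg_mem_hexLabels` of the proof of `stub_layeredGluing` (S5a); see the final part's module docstring. -/
theorem neg_mem_hexLabels {l : ℤ × ℤ × ℤ} (hl : l ∈ hexLabels) : -l ∈ hexLabels := by
  revert l; decide

/-- Auxiliary step `layeredPos_neg_hex` of the proof of `stub_layeredGluing` (S5a); see the final part's module docstring. -/
theorem layeredPos_neg_hex (hz0 : z 0 = 0) {l : ℤ × ℤ × ℤ} (hl : l ∈ hexLabels) :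
    layeredPos a s z (-l) = -layeredPos a s z l := by
  rw [layeredPos_of_mem_hexLabels hz0 hl, layeredPos_of_mem_hexLabels hz0 (neg_mem_hexLabels hl)]
  obtain ⟨m, i, j⟩ := l
  simp only [Prod.neg_mk]
  push_cast
  module

/-- Auxiliary step `eq_sqrt_two_thirds_mul` of the proof of `stub_layeredGluing` (S5a); see the final part's module docstring. -/
theorem eq_sqrt_two_thirds_mul {h a : ℝ} (hpos : 0 < h) (ha : 0 < a) (hsq : h ^ 2 = 2 / 3 * a ^ 2) :
    h = Real.sqrt (2 / 3) * a := by
  have h1 : (Real.sqrt (2 / 3) * a) ^ 2 = 2 / 3 * a ^ 2 := by rw [mul_pow, sqrt_two_thirds_sq]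
  have h2 : 0 < Real.sqrt (2 / 3) * a := by have := sqrt_two_thirds_bounds.1; positivity
  exact (pow_left_inj₀ hpos.le h2.le two_ne_zero).1 (hsq.trans h1.symm)

/-- Antipodal up/down neighbour sites force the cubic pattern (label form). -/
theorem up_down_antipodal (hbox : InBox a z) (hs : IsHaggSeq s) {x y : ℤ × ℤ × ℤ}
    (hx : x ∈ upLabels (s 0)) (hy : y ∈ downLabels (s (-1)))
    (h : layeredPos a s z y = -layeredPos a s z x) : s (-1) = s 0 ∧ z (-1) = -z 1 := by
  obtain ⟨m, i, j⟩ := x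
  obtain ⟨m', i', j'⟩ := y
  have h1 := upLabels_fst hx
  have h2 := downLabels_fst hy
  simp only at h1 h2
  subst h1; subst h2
  exact cubic_of_antipodal hbox hs h

/-- `u ≠ -v` in coordinates: the second coordinate of `v` is nonzero. -/
theorem triangularVec₂_one_ne_zero (ha : 0 < a) : (triangularVec₂ a) 1 ≠ 0 := by
  simp [triangularVec₂]; exact ha.ne'

/-- **Tilted templates are cubic-ideal.** If the frame of the template at `q` tilts the vertical,
then its spacing is `a` and it is cubic-ideal at its base layer. -/
theorem gs_tilted_cubic' (hH : HalfFramedAt a Y q s z) (hT : TemplateAt Y q E a' s' z')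
    (htilt : E.symm (layerNormal 1) ≠ layerNormal 1 ∧ E.symm (layerNormal 1) ≠ -layerNormal 1) :
    a' = a ∧ CubicAt a s' z' := by
  obtain ⟨φ, hφ, hinj, -⟩ := exists_phi hH hT
  obtain ⟨hbox, hs, hz0, -, -⟩ := hH
  obtain ⟨hbox', hs', hz0', -, -⟩ := hT
  set ν := E.symm (layerNormal 1) with hν
  have hνn : ‖ν‖ = 1 := norm_frame_normal E
  have ha := hbox.a_pos
  have hhex : ∀ l ∈ hexLabels, l ∈ nbrLabels s := fun l hl => mem_nbrLabels.2 (Or.inl hl)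
  -- orthogonality and norms of the hexagon images
  have horth : ∀ l ∈ hexLabels, ⟪layeredPos a' s' z' (φ l), ν⟫_ℝ = 0 := by
    intro l hl
    rw [← inner_frame_two, (hφ l (hhex l hl)).2, layeredPos_of_mem_hexLabels hz0 hl]
    simp [triangularVec₁, triangularVec₂]
  have hnorm : ∀ l ∈ hexLabels, ‖layeredPos a' s' z' (φ l)‖ = a := by
    intro l hl
    rw [← LinearIsometryEquiv.norm_map E, (hφ l (hhex l hl)).2, norm_hexSite hbox hz0 hl]
  -- the hexagon lemma
  have hinjH : Set.InjOn φ hexLabels := fun x hx y hy h => hinj (hhex x hx) (hhex y hy) h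
  have hFcard : 5 ≤ (hexLabels.image φ).card := by
    rw [Finset.card_image_of_injOn hinjH]; decide
  obtain ⟨haa, hz1sq, hzm1sq⟩ := hexagon_lemma hbox' hs' hz0' hνn htilt ha (by linarith [hbox.2.1])
    (hexLabels.image φ) hFcard
    (fun l' hl' => by obtain ⟨l, hl, rfl⟩ := Finset.mem_image.1 hl'; exact hnorm l hl)
    (fun l' hl' => by obtain ⟨l, hl, rfl⟩ := Finset.mem_image.1 hl'; exact horth l hl)
  have hz1pos : 0 < z' 1 := by have := (hbox'.z_one hz0').1; linarith [hbox'.a_pos]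
  have hzm1neg : z' (-1) < 0 := by have := (hbox'.z_neg_one hz0').1; linarith [hbox'.a_pos]
  -- antipodes
  have hanti : ∀ l ∈ hexLabels, layeredPos a' s' z' (φ (-l)) = -layeredPos a' s' z' (φ l) := by
    intro l hl
    apply E.injective
    rw [map_neg, (hφ l (hhex l hl)).2, (hφ (-l) (hhex _ (neg_mem_hexLabels hl))).2,
      layeredPos_neg_hex hz0 hl]
  have pair : ∀ l ∈ hexLabels, (φ l ∈ upLabels (s' 0) ∨ φ l ∈ downLabels (s' (-1))) →
      s' (-1) = s' 0 ∧ z' (-1) = -z' 1 := by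
    intro l hl hcase
    have hφnl := (hφ (-l) (hhex _ (neg_mem_hexLabels hl))).1
    have han := hanti l hl
    have h2 := congrArg (fun x : EuclideanSpace ℝ (Fin 3) => x 2) han
    simp only [PiLp.neg_apply, layeredPos_apply_two] at h2
    rcases hcase with hup | hdn
    · rw [upLabels_fst hup] at h2
      rcases mem_nbrLabels.1 hφnl with h | h | h
      · rw [hexLabels_fst h, hz0'] at h2; linarith
      · rw [upLabels_fst h] at h2; linarith
      · exact up_down_antipodal hbox' hs' hup h han
    · rw [downLabels_fst hdn] at h2
      rcases mem_nbrLabels.1 hφnl with h | h | h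
      · rw [hexLabels_fst h, hz0'] at h2; linarith
      · exact up_down_antipodal hbox' hs' h hdn (by rw [han, neg_neg])
      · rw [downLabels_fst h] at h2; linarith
  have hcub : s' (-1) = s' 0 ∧ z' (-1) = -z' 1 := by
    have hu0 : ((0 : ℤ), (1 : ℤ), (0 : ℤ)) ∈ hexLabels := by decide
    have hv0 : ((0 : ℤ), (0 : ℤ), (1 : ℤ)) ∈ hexLabels := by decide
    by_cases hu : φ (0, 1, 0) ∈ hexLabels
    · by_cases hv : φ (0, 0, 1) ∈ hexLabels
      · exfalso
        have o1 := horth _ hu0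
        have o2 := horth _ hv0
        rw [layeredPos_of_mem_hexLabels hz0' hu] at o1
        rw [layeredPos_of_mem_hexLabels hz0' hv] at o2
        have hdet : ((φ (0, 1, 0)).2.1 : ℝ) * (φ (0, 0, 1)).2.2 - (φ (0, 0, 1)).2.1 * (φ (0, 1, 0)).2.2 ≠ 0 := by
          have hdet' : (φ (0, 1, 0)).2.1 * (φ (0, 0, 1)).2.2 - (φ (0, 0, 1)).2.1 * (φ (0, 1, 0)).2.2 ≠ 0 := by
            intro h0
            rcases hex_det2 _ hu _ hv h0 with h | h
            · have := hinjH hv0 hu0 h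
              simp at this
            · have e1 := (hφ _ (hhex _ hv0)).2
              have e2 := (hφ _ (hhex _ hu0)).2
              rw [h, layeredPos_neg_hex hz0' hu, map_neg, e2] at e1
              have := congrArg (fun x : EuclideanSpace ℝ (Fin 3) => x 1) e1
              simp only [PiLp.neg_apply, layeredPos_layer_zero hz0, Int.cast_zero, Int.cast_one, zero_smul,
                one_smul, add_zero, zero_add] at this
              have hv1 := triangularVec₂_one_ne_zero ha
              have hu1 : (triangularVec₁ a) 1 = 0 := by simp [triangularVec₁]
              rw [hu1, neg_zero] at this
              exact hv1 this.symm
          exact_mod_cast hdet'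
        have := nu_vertical hbox'.a_pos.ne' hdet o1 o2
        rcases eq_layerNormal_of_horizontal_zero hνn this.1 this.2 with h' | h'
        · exact htilt.1 h'
        · exact htilt.2 h'
      · exact pair _ hv0 ((mem_nbrLabels.1 (hφ _ (hhex _ hv0)).1).resolve_left hv)
    · exact pair _ hu0 ((mem_nbrLabels.1 (hφ _ (hhex _ hu0)).1).resolve_left hu)
  subst haa
  refine ⟨rfl, hcub.1, ?_, ?_⟩
  · exact eq_sqrt_two_thirds_mul hz1pos ha hz1sq
  · rw [hcub.2, eq_sqrt_two_thirds_mul hz1pos ha hz1sq]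

/-- In a cubic-ideal template the antipode of a neighbour site is a neighbour site. -/
theorem cubicAt_neg_site (hz0 : z 0 = 0) (hc : CubicAt a s z) {l : ℤ × ℤ × ℤ} (hl : -1 ≤ l.1 ∧ l.1 ≤ 1) :
    layeredPos a s z (-l) = -layeredPos a s z l := by
  have hl' : -1 ≤ (-l).1 ∧ (-l).1 ≤ 1 := by obtain ⟨m, i, j⟩ := l; simp only [Prod.neg_mk] at hl ⊢; omega
  rw [layeredPos_eq_fcc_of_cubicAt hz0 hc hl, layeredPos_eq_fcc_of_cubicAt hz0 hc hl', ← fcc_neg]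

/-- All twelve neighbour sites of a cubic-ideal template have norm `a`. -/
theorem norm_nbrSite_cubic (hbox : InBox a z) (hs : IsHaggSeq s) (hz0 : z 0 = 0) (hc : CubicAt a s z)
    {l : ℤ × ℤ × ℤ} (hl : l ∈ nbrLabels s) : ‖layeredPos a s z l‖ = a := by
  have ha := hbox.a_pos
  have h23 := sqrt_two_thirds_sq
  rcases mem_nbrLabels.1 hl with h | h | h
  · exact norm_hexSite hbox hz0 h
  · have hsq := norm_sq_upSite (a := a) (z := z) hs h
    rw [hc.2.1, mul_pow, h23] at hsq
    have : ‖layeredPos a s z l‖ ^ 2 = a ^ 2 := by rw [hsq]; ring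
    exact (pow_left_inj₀ (norm_nonneg _) ha.le two_ne_zero).1 this
  · have hsq := norm_sq_downSite (a := a) (z := z) hs h
    rw [hc.2.2, neg_pow, mul_pow, h23] at hsq
    have : ‖layeredPos a s z l‖ ^ 2 = a ^ 2 := by rw [hsq]; ring
    exact (pow_left_inj₀ (norm_nonneg _) ha.le two_ne_zero).1 this

/-- **The known structure is cubic-ideal too** (tilted case). -/
theorem gs_tilted_cubic (hH : HalfFramedAt a Y q s z) (hT : TemplateAt Y q E a' s' z')
    (htilt : E.symm (layerNormal 1) ≠ layerNormal 1 ∧ E.symm (layerNormal 1) ≠ -layerNormal 1) :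
    CubicAt a s z := by
  obtain ⟨haa, hc'⟩ := gs_tilted_cubic' hH hT htilt
  subst a'
  obtain ⟨φ, hφ, -, -⟩ := exists_phi hH hT
  obtain ⟨hbox, hs, hz0, hK, -⟩ := hH
  obtain ⟨hbox', hs', hz0', -, hN2⟩ := hT
  have ha := hbox.a_pos
  have hup0 : ((1 : ℤ), (0 : ℤ), (0 : ℤ)) ∈ upLabels (s 0) := by simp [upLabels]
  have hl0 : ((1 : ℤ), (0 : ℤ), (0 : ℤ)) ∈ nbrLabels s := mem_nbrLabels.2 (Or.inr (Or.inl hup0))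
  obtain ⟨hφl, he⟩ := hφ _ hl0
  have hnorm : ‖layeredPos a s z (1, 0, 0)‖ = a := by
    rw [← he, LinearIsometryEquiv.norm_map]; exact norm_nbrSite_cubic hbox' hs' hz0' hc' hφl
  -- the antipode `q - lP(1,0,0)` is in `Y`
  have hneg : layeredPos a s' z' (-φ (1, 0, 0)) = -layeredPos a s' z' (φ (1, 0, 0)) :=
    cubicAt_neg_site hz0' hc' (nbrLabels_fst_le hφl)
  have hmem : q + -layeredPos a s z (1, 0, 0) ∈ Y := by
    have := hN2 (-φ (1, 0, 0)) (by rw [hneg, norm_neg, ← LinearIsometryEquiv.norm_map E, he, hnorm]; linarith [hbox.2.1])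
    rwa [hneg, map_neg, he] at this
  have hz1 := hbox.z_one hz0
  obtain ⟨l₂, hl₂⟩ := hK _ hmem (by rw [dist_eq_norm, add_sub_cancel_left, norm_neg, hnorm]; linarith [hbox.2.1])
    (by simp only [PiLp.add_apply, PiLp.neg_apply, layeredPos_apply_two]; linarith [hz1.1])
  rw [add_right_inj] at hl₂
  -- `l₂` is a lower neighbour
  have hl₂n : ‖layeredPos a s z l₂‖ = a := by rw [← hl₂, norm_neg, hnorm]
  have hl₂0 : l₂ ≠ 0 := by
    intro h0
    rw [h0, show (0 : ℤ × ℤ × ℤ) = ((0 : ℤ), (0 : ℤ), (0 : ℤ)) from rfl, layeredPos_origin hz0, norm_zero] at hl₂n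
    linarith
  have hl₂mem := mem_labels_of_norm_le hbox hs hz0 hl₂0 (by linarith [hbox.2.1])
  have h2 := congrArg (fun x : EuclideanSpace ℝ (Fin 3) => x 2) hl₂
  simp only [PiLp.neg_apply, layeredPos_apply_two] at h2
  rcases hl₂mem with h | h | h
  · rw [hexLabels_fst h, hz0] at h2; linarith [hz1.1]
  · rw [upLabels_fst h] at h2; linarith [hz1.1]
  · obtain ⟨hs1, hzz⟩ := up_down_antipodal hbox hs hup0 h hl₂.symm
    have hz1eq : z 1 = Real.sqrt (2 / 3) * a := by
      have hsq := norm_sq_upSite (a := a) (z := z) hs hup0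
      rw [hnorm] at hsq
      exact eq_sqrt_two_thirds_mul (by linarith [hz1.1]) ha (by linarith)
    exact ⟨hs1, hz1eq, by rw [hzz, hz1eq]⟩

/-- Auxiliary step `nu_real_R1` of the proof of `stub_layeredGluing` (S5a); see the final part's module docstring. -/
theorem nu_real_R1 (a h n0 n1 n2 : ℝ) (ha : a ≠ 0) (hh : h ^ 2 = 2 / 3 * a ^ 2) (hN : n0 ^ 2 + n1 ^ 2 + n2 ^ 2 = 1)
    (o1 : a / 2 * n0 + a * √3 / 6 * n1 + h * n2 = 0) (o2 : -(a / 2) * n0 + a * √3 / 6 * n1 + h * n2 = 0) :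
    n2 ^ 2 = 1 / 9 := by
  have h3 : (√3 : ℝ) ^ 2 = 3 := Real.sq_sqrt (by norm_num)
  have e1 : a * n0 = 0 := by linear_combination o1 - o2
  have hn0 : n0 = 0 := (mul_eq_zero.1 e1).resolve_left ha
  have e2 : a * √3 / 3 * n1 = -(2 * h * n2) := by linear_combination o1 + o2
  have sq : (a * √3 / 3 * n1) ^ 2 = (2 * h * n2) ^ 2 := by rw [e2]; ring
  have e3 : a ^ 2 * n1 ^ 2 = a ^ 2 * (8 * n2 ^ 2) := by
    have : a ^ 2 * (√3) ^ 2 / 9 * n1 ^ 2 = 4 * h ^ 2 * n2 ^ 2 := by linear_combination sq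
    rw [h3, hh] at this; linarith
  have e4 := mul_left_cancel₀ (pow_ne_zero 2 ha) e3
  rw [hn0] at hN; nlinarith

/-- Auxiliary step `nu_real_R2` of the proof of `stub_layeredGluing` (S5a); see the final part's module docstring. -/
theorem nu_real_R2 (a h n0 n1 n2 : ℝ) (ha : a ≠ 0) (hh : h ^ 2 = 2 / 3 * a ^ 2) (hN : n0 ^ 2 + n1 ^ 2 + n2 ^ 2 = 1)
    (o1 : a / 2 * n0 + a * √3 / 6 * n1 + h * n2 = 0) (o2 : -(a * √3 / 3) * n1 + h * n2 = 0) :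
    n2 ^ 2 = 1 / 9 := by
  have h3 : (√3 : ℝ) ^ 2 = 3 := Real.sq_sqrt (by norm_num)
  have e1 : a / 2 * n0 = -(a * √3 / 2 * n1) := by linear_combination o1 - o2
  have sq1 : (a / 2 * n0) ^ 2 = (a * √3 / 2 * n1) ^ 2 := by rw [e1]; ring
  have e2 : a ^ 2 * n0 ^ 2 = a ^ 2 * (3 * n1 ^ 2) := by
    have : a ^ 2 / 4 * n0 ^ 2 = a ^ 2 * (√3) ^ 2 / 4 * n1 ^ 2 := by linear_combination sq1
    rw [h3] at this; linarith
  have e2' := mul_left_cancel₀ (pow_ne_zero 2 ha) e2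
  have e3 : h * n2 = a * √3 / 3 * n1 := by linear_combination o2
  have sq2 : (h * n2) ^ 2 = (a * √3 / 3 * n1) ^ 2 := by rw [e3]
  have e4 : a ^ 2 * (2 * n2 ^ 2) = a ^ 2 * n1 ^ 2 := by
    have : h ^ 2 * n2 ^ 2 = a ^ 2 * (√3) ^ 2 / 9 * n1 ^ 2 := by linear_combination sq2
    rw [h3, hh] at this; linarith
  have e4' := mul_left_cancel₀ (pow_ne_zero 2 ha) e4
  nlinarith

/-- Auxiliary step `nu_real_R3` of the proof of `stub_layeredGluing` (S5a); see the final part's module docstring. -/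
theorem nu_real_R3 (a h n0 n1 n2 : ℝ) (ha : a ≠ 0) (hh : h ^ 2 = 2 / 3 * a ^ 2) (hN : n0 ^ 2 + n1 ^ 2 + n2 ^ 2 = 1)
    (o1 : -(a / 2) * n0 + a * √3 / 6 * n1 + h * n2 = 0) (o2 : -(a * √3 / 3) * n1 + h * n2 = 0) :
    n2 ^ 2 = 1 / 9 :=
  nu_real_R2 a h (-n0) n1 n2 ha hh (by linarith [hN, show (-n0)^2 = n0^2 by ring]) (by linarith) o2

/-- **The tilt is that of a cube diagonal**: two distinct upper-triangle sites of a cubic-ideal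
template orthogonal to a unit vector `ν` force `ν₂² = 1/9`. -/
theorem nu_sq_of_two_up (hbox : InBox a z) (hs : IsHaggSeq s) (hc : CubicAt a s z) {ν : EuclideanSpace ℝ (Fin 3)} (hν : ‖ν‖ = 1)
    {t₁ t₂ : ℤ × ℤ × ℤ} (h1 : t₁ ∈ upLabels (s 0)) (h2 : t₂ ∈ upLabels (s 0)) (hne : t₁ ≠ t₂)
    (o1 : ⟪layeredPos a s z t₁, ν⟫_ℝ = 0) (o2 : ⟪layeredPos a s z t₂, ν⟫_ℝ = 0) : ν 2 ^ 2 = 1 / 9 := by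
  have ha := hbox.a_pos
  have h3 : (√3 : ℝ) ^ 2 = 3 := Real.sq_sqrt (by norm_num)
  have h3' : (0 : ℝ) < √3 := by positivity
  have hN : ν 0 ^ 2 + ν 1 ^ 2 + ν 2 ^ 2 = 1 := by have := norm_sq_fin3 ν; rw [hν] at this; linarith
  have hh2 : z 1 ^ 2 = 2 / 3 * a ^ 2 := by rw [hc.2.1, mul_pow, sqrt_two_thirds_sq]
  have hσ := hs 0
  simp only [upLabels, Finset.mem_insert, Finset.mem_singleton] at h1 h2
  have hN' : (-ν 0) ^ 2 + (-ν 1) ^ 2 + ν 2 ^ 2 = 1 := by rw [neg_sq, neg_sq]; exact hN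
  set h := z 1 with hh
  rcases h1 with rfl | rfl | rfl <;> rcases h2 with rfl | rfl | rfl
  all_goals first
    | exact absurd rfl hne
    | (simp only [real_inner_fin3, layeredPos_apply_zero, layeredPos_apply_one, layeredPos_apply_two,
          haggLabel_one, ← hh] at o1 o2
       rcases hσ with hσ | hσ <;> simp only [hσ, Int.cast_one, Int.cast_neg, Int.cast_zero] at o1 o2
       · first
         | exact nu_real_R1 a h (ν 0) (ν 1) (ν 2) ha.ne' hh2 hN (by linear_combination o1) (by linear_combination o2)
         | exact nu_real_R1 a h (ν 0) (ν 1) (ν 2) ha.ne' hh2 hN (by linear_combination o2) (by linear_combination o1)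
         | exact nu_real_R2 a h (ν 0) (ν 1) (ν 2) ha.ne' hh2 hN (by linear_combination o1) (by linear_combination o2)
         | exact nu_real_R2 a h (ν 0) (ν 1) (ν 2) ha.ne' hh2 hN (by linear_combination o2) (by linear_combination o1)
         | exact nu_real_R3 a h (ν 0) (ν 1) (ν 2) ha.ne' hh2 hN (by linear_combination o1) (by linear_combination o2)
         | exact nu_real_R3 a h (ν 0) (ν 1) (ν 2) ha.ne' hh2 hN (by linear_combination o2) (by linear_combination o1)
       · first
         | exact nu_real_R1 a h (-ν 0) (-ν 1) (ν 2) ha.ne' hh2 hN' (by linear_combination o1) (by linear_combination o2)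
         | exact nu_real_R1 a h (-ν 0) (-ν 1) (ν 2) ha.ne' hh2 hN' (by linear_combination o2) (by linear_combination o1)
         | exact nu_real_R2 a h (-ν 0) (-ν 1) (ν 2) ha.ne' hh2 hN' (by linear_combination o1) (by linear_combination o2)
         | exact nu_real_R2 a h (-ν 0) (-ν 1) (ν 2) ha.ne' hh2 hN' (by linear_combination o2) (by linear_combination o1)
         | exact nu_real_R3 a h (-ν 0) (-ν 1) (ν 2) ha.ne' hh2 hN' (by linear_combination o1) (by linear_combination o2)
         | exact nu_real_R3 a h (-ν 0) (-ν 1) (ν 2) ha.ne' hh2 hN' (by linear_combination o2) (by linear_combination o1))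

/-- Common facts about the label correspondence in the tilted case. -/
theorem gs_phi_facts (hH : HalfFramedAt a Y q s z) {φ : ℤ × ℤ × ℤ → ℤ × ℤ × ℤ}
    (hφ : ∀ l ∈ nbrLabels s, φ l ∈ nbrLabels s' ∧ E (layeredPos a' s' z' (φ l)) = layeredPos a s z l) :
    (∀ l ∈ hexLabels, ⟪layeredPos a' s' z' (φ l), E.symm (layerNormal 1)⟫_ℝ = 0) ∧
    (∀ l ∈ hexLabels, layeredPos a' s' z' (φ (-l)) = -layeredPos a' s' z' (φ l)) := by
  obtain ⟨hbox, hs, hz0, -, -⟩ := hH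
  have hhex : ∀ l ∈ hexLabels, l ∈ nbrLabels s := fun l hl => mem_nbrLabels.2 (Or.inl hl)
  constructor
  · intro l hl
    rw [← inner_frame_two, (hφ l (hhex l hl)).2, layeredPos_of_mem_hexLabels hz0 hl]
    simp [triangularVec₁, triangularVec₂]
  · intro l hl
    apply E.injective
    rw [map_neg, (hφ l (hhex l hl)).2, (hφ (-l) (hhex _ (neg_mem_hexLabels hl))).2,
      layeredPos_neg_hex hz0 hl]

/-- Landing anchor of this file (registered stub of crux stmt-AtomisticToContinuum-13603; re-exports a result above). -/
theorem layeredGluing_part08_anchor :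
    ∀ (l : ℤ × ℤ × ℤ), l ∈ hexLabels → -l ∈ hexLabels :=
  fun _ h => neg_mem_hexLabels h

end GenericStep
end Sites

end Summit.AtomisticToContinuum.Crystallization.Theorems.PrestressSplitKorn
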